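import Mathlib.NumberTheory.ArithmeticFunction.Moebius
import Mathlib.NumberTheory.Divisors
import Mathlib.Data.Nat.GCD.Basic
import HarnessLib

/-!
# The Hecke relation for the divisor function: `τ(u)τ(v) = Σ_{c ∣ (u,v)} τ(uv/c²)`

Topic `Literature/NumberTheory/Multiplicative` (namespace `Literature.NumberTheory.Multiplicative`).
Elementary, fully PROVED (no named facts).

`τ = σ₀` is the `n`-th Fourier coefficient of the weight-0 Eisenstein series, so it satisfies the
Hecke multiplicativity relation `τ(u)τ(v) = Σ_{c ∣ gcd(u,v)} τ(uv/c²)` — the same relation as the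
Hecke eigenvalues `λ_f(m)λ_f(n) = Σ_{d ∣ (m,n)} λ_f(mn/d²)` of a newform at primes not dividing the
level ([KowalskiMichelVanderKam2000] (10); [BuiPrattZaharescu2023] Lemma 3.1). We give the
elementary counting proof:

* `card_divisors_mul_eq_card_coprime_pairs` — every divisor `D` of `uv` factors uniquely as
  `D = (u/d)·e` with `d ∣ u`, `e ∣ v`, `gcd(d, e) = 1` (namely `u/d = gcd(D,u)`), so
  `τ(uv) = #{(d,e) : d ∣ u, e ∣ v, (d,e) = 1}`;
* `card_divisors_mul_card_divisors_eq_sum` — sorting the pairs `(d,e) ∈ div u × div v` by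
  `c = gcd(d,e)` gives `τ(u)τ(v) = Σ_{c ∣ (u,v)} τ((u/c)(v/c))`.

Typed for the LANDAU–SIEGEL PROGRAMME (cell `landau-siegel`, §B-fam): it is the arithmetic input
(N1) of the «Selberg coordinates» bridge between the KMV second-moment kernel
`K(n₁,n₂) = (n₁n₂)⁻¹ Σ_{c∣(n₁,n₂)} c·τ(n₁n₂/c²)(…)` (`KMV2000.kmvKernel`) and the diagonalised form
`KMV2000.SelbergCoord.scForm`. FRAMING: nothing here is a claim about `L`-functions.

## References
* [KowalskiMichelVanderKam2000] E. Kowalski, P. Michel, J. VanderKam, J. reine angew. Math. 526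
  (2000), (10) p. 7 (Hecke relation).
* [BuiPrattZaharescu2023] H. M. Bui, K. Pratt, A. Zaharescu, arXiv:2102.03087, Lemma 3.1.
-/

open Finset

namespace Literature.NumberTheory.Multiplicative

/-! ### Divisors of a product as coprime pairs -/

/-- For `D ∣ uv` (`u ≠ 0`): `D / gcd(D,u)` divides `v`. [folklore] -/
private theorem div_gcd_dvd_of_dvd_mul {D u v : ℕ} (hu : u ≠ 0) (hD : D ∣ u * v) :
    D / Nat.gcd D u ∣ v := by
  set g := Nat.gcd D u with hgdef
  have hg : 0 < g := Nat.gcd_pos_of_pos_right _ (Nat.pos_of_ne_zero hu)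
  have hcop : Nat.Coprime (D / g) (u / g) := Nat.coprime_div_gcd_div_gcd hg
  obtain ⟨D', hD'⟩ := Nat.gcd_dvd_left D u
  obtain ⟨u', hu'⟩ := Nat.gcd_dvd_right D u
  rw [← hgdef] at hD' hu'
  have hDg : D / g = D' := by rw [hD', Nat.mul_div_cancel_left D' hg]
  have hug : u / g = u' := by rw [hu', Nat.mul_div_cancel_left u' hg]
  rw [hDg, hug] at hcop
  rw [hDg]
  have h1 : D' ∣ u' * v := by
    have : g * D' ∣ g * (u' * v) := by rw [← mul_assoc, ← hu', ← hD']; exact hD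
    exact Nat.dvd_of_mul_dvd_mul_left hg this
  exact hcop.dvd_of_dvd_mul_left h1

/-- **Divisors of a product as coprime pairs.** For `u, v ≥ 1` the map
`D ↦ (u / gcd(D,u), D / gcd(D,u))` is a bijection from the divisors of `uv` onto the pairs
`(d, e)` with `d ∣ u`, `e ∣ v`, `gcd(d,e) = 1` (inverse `(d,e) ↦ (u/d)·e`); hence
`τ(uv) = #{(d,e) ∈ div u × div v : (d,e) = 1}` — the counting lemma behind the Hecke relation
for `τ`. [cite: KowalskiMichelVanderKam2000, (10) p. 7 (derivation: the divisor function `τ = 1 ⋆ 1`; counting form)] -/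
theorem card_divisors_mul_eq_card_coprime_pairs {u v : ℕ} (hu : u ≠ 0) (hv : v ≠ 0) :
    (u * v).divisors.card =
      ((u.divisors ×ˢ v.divisors).filter (fun p => Nat.Coprime p.1 p.2)).card := by
  symm
  refine Finset.card_bij' (fun p _ => u / p.1 * p.2) (fun D _ => (u / Nat.gcd D u, D / Nat.gcd D u))
    ?_ ?_ ?_ ?_
  · -- maps into divisors of `uv`
    rintro ⟨d, e⟩ hp
    simp only [mem_filter, mem_product, Nat.mem_divisors] at hp
    obtain ⟨⟨⟨hd, -⟩, ⟨he, -⟩⟩, -⟩ := hp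
    exact Nat.mem_divisors.mpr ⟨mul_dvd_mul (Nat.div_dvd_of_dvd hd) he, mul_ne_zero hu hv⟩
  · -- maps into coprime pairs
    intro D hD
    obtain ⟨hDuv, -⟩ := Nat.mem_divisors.mp hD
    have hg : 0 < Nat.gcd D u := Nat.gcd_pos_of_pos_right _ (Nat.pos_of_ne_zero hu)
    simp only [mem_filter, mem_product, Nat.mem_divisors]
    refine ⟨⟨⟨Nat.div_dvd_of_dvd (Nat.gcd_dvd_right D u), hu⟩, ⟨div_gcd_dvd_of_dvd_mul hu hDuv, hv⟩⟩, ?_⟩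
    exact (Nat.coprime_div_gcd_div_gcd hg).symm
  · -- left inverse: (d,e) ↦ D ↦ (d,e)
    rintro ⟨d, e⟩ hp
    simp only [mem_filter, mem_product, Nat.mem_divisors] at hp
    obtain ⟨⟨⟨hd, -⟩, ⟨-, -⟩⟩, hcop⟩ := hp
    obtain ⟨k, hk⟩ := hd
    have hd0 : 0 < d := Nat.pos_of_ne_zero (by rintro rfl; exact hu (by simpa using hk))
    have hk0 : 0 < k := Nat.pos_of_ne_zero (by rintro rfl; exact hu (by simpa using hk))
    have huk : u / d = k := by rw [hk, Nat.mul_div_cancel_left k hd0]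
    have hgcd : Nat.gcd (u / d * e) u = k := by
      rw [huk, hk, mul_comm d k, Nat.gcd_mul_left, Nat.Coprime.gcd_eq_one hcop.symm, mul_one]
    refine Prod.ext ?_ ?_
    · show u / Nat.gcd (u / d * e) u = d
      rw [hgcd, hk, Nat.mul_div_cancel _ hk0]
    · show u / d * e / Nat.gcd (u / d * e) u = e
      rw [hgcd, huk, Nat.mul_div_cancel_left e hk0]
  · -- right inverse: D ↦ (d,e) ↦ D
    intro D hD
    have hug : Nat.gcd D u ∣ u := Nat.gcd_dvd_right D u
    have hDg : Nat.gcd D u ∣ D := Nat.gcd_dvd_left D u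
    show u / (u / Nat.gcd D u) * (D / Nat.gcd D u) = D
    rw [Nat.div_div_self hug hu, Nat.mul_div_cancel' hDg]

/-! ### The Hecke relation -/

/-- Pairs `(d,e) ∈ div u × div v` with `gcd(d,e) = c` correspond to coprime pairs in
`div(u/c) × div(v/c)` under `(d',e') ↦ (cd', ce')` (`c ∣ u`, `c ∣ v`). [folklore] -/
private theorem card_pairs_gcd_eq {u v c : ℕ} (hu : u ≠ 0) (hv : v ≠ 0) (hcu : c ∣ u) (hcv : c ∣ v) :
    ((u.divisors ×ˢ v.divisors).filter (fun p => Nat.gcd p.1 p.2 = c)).card =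
      (((u / c).divisors ×ˢ (v / c).divisors).filter (fun p => Nat.Coprime p.1 p.2)).card := by
  have hc0 : c ≠ 0 := by rintro rfl; exact hu (zero_dvd_iff.mp hcu)
  have hcpos : 0 < c := Nat.pos_of_ne_zero hc0
  obtain ⟨u', rfl⟩ := hcu
  obtain ⟨v', rfl⟩ := hcv
  have hu' : u' ≠ 0 := by rintro rfl; exact hu (mul_zero c)
  have hv' : v' ≠ 0 := by rintro rfl; exact hv (mul_zero c)
  rw [Nat.mul_div_cancel_left u' hcpos, Nat.mul_div_cancel_left v' hcpos]
  symm
  refine Finset.card_bij' (fun p _ => (c * p.1, c * p.2)) (fun p _ => (p.1 / c, p.2 / c)) ?_ ?_ ?_ ?_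
  · rintro ⟨d, e⟩ hp
    simp only [mem_filter, mem_product, Nat.mem_divisors] at hp ⊢
    obtain ⟨⟨⟨hd, -⟩, ⟨he, -⟩⟩, hcop⟩ := hp
    refine ⟨⟨⟨mul_dvd_mul_left c hd, hu⟩, ⟨mul_dvd_mul_left c he, hv⟩⟩, ?_⟩
    rw [Nat.gcd_mul_left, Nat.Coprime.gcd_eq_one hcop, mul_one]
  · rintro ⟨d, e⟩ hp
    simp only [mem_filter, mem_product, Nat.mem_divisors] at hp ⊢
    obtain ⟨⟨⟨hd, -⟩, ⟨he, -⟩⟩, hg⟩ := hp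
    have hcd : c ∣ d := hg ▸ Nat.gcd_dvd_left d e
    have hce : c ∣ e := hg ▸ Nat.gcd_dvd_right d e
    obtain ⟨d', rfl⟩ := hcd
    obtain ⟨e', rfl⟩ := hce
    rw [Nat.mul_div_cancel_left d' hcpos, Nat.mul_div_cancel_left e' hcpos]
    refine ⟨⟨⟨Nat.dvd_of_mul_dvd_mul_left hcpos hd, hu'⟩, ⟨Nat.dvd_of_mul_dvd_mul_left hcpos he, hv'⟩⟩, ?_⟩
    rw [Nat.gcd_mul_left] at hg
    have : Nat.gcd d' e' = 1 := by
      have h := hg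
      nth_rewrite 2 [← mul_one c] at h
      exact Nat.eq_of_mul_eq_mul_left hcpos h
    exact this
  · rintro ⟨d, e⟩ hp
    show (c * d / c, c * e / c) = (d, e)
    rw [Nat.mul_div_cancel_left d hcpos, Nat.mul_div_cancel_left e hcpos]
  · rintro ⟨d, e⟩ hp
    simp only [mem_filter, mem_product, Nat.mem_divisors] at hp
    obtain ⟨-, hg⟩ := hp
    have hcd : c ∣ d := hg ▸ Nat.gcd_dvd_left d e
    have hce : c ∣ e := hg ▸ Nat.gcd_dvd_right d e
    show (c * (d / c), c * (e / c)) = (d, e)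
    rw [Nat.mul_div_cancel' hcd, Nat.mul_div_cancel' hce]

/-- **Hecke relation for the divisor function** (sum form): for `u, v ≥ 1`,
`τ(u)·τ(v) = Σ_{c ∣ gcd(u,v)} τ((u/c)·(v/c))` (`= Σ_{c ∣ (u,v)} τ(uv/c²)`); `τ n = #(n.divisors)`.
Proof: sort `div u × div v` by `c = gcd(d,e)` and count each fibre with the two lemmas above.
[cite: KowalskiMichelVanderKam2000, (10) p. 7 (derivation: the divisor function `τ = 1 ⋆ 1` is a Hecke eigenvalue system of level 1)] -/
theorem card_divisors_mul_card_divisors_eq_sum {u v : ℕ} (hu : u ≠ 0) (hv : v ≠ 0) :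
    u.divisors.card * v.divisors.card =
      ∑ c ∈ (Nat.gcd u v).divisors, ((u / c) * (v / c)).divisors.card := by
  rw [← Finset.card_product]
  have hmaps : ∀ p ∈ u.divisors ×ˢ v.divisors, Nat.gcd p.1 p.2 ∈ (Nat.gcd u v).divisors := by
    rintro ⟨d, e⟩ hp
    simp only [mem_product, Nat.mem_divisors] at hp
    obtain ⟨⟨hd, -⟩, ⟨he, -⟩⟩ := hp
    exact Nat.mem_divisors.mpr ⟨Nat.dvd_gcd ((Nat.gcd_dvd_left d e).trans hd) ((Nat.gcd_dvd_right d e).trans he),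
      Nat.gcd_ne_zero_left hu⟩
  rw [Finset.card_eq_sum_card_fiberwise (f := fun p : ℕ × ℕ => Nat.gcd p.1 p.2)
    (t := (Nat.gcd u v).divisors) (fun p hp => hmaps p hp)]
  · refine Finset.sum_congr rfl fun c hc => ?_
    obtain ⟨hcg, -⟩ := Nat.mem_divisors.mp hc
    have hcu : c ∣ u := hcg.trans (Nat.gcd_dvd_left u v)
    have hcv : c ∣ v := hcg.trans (Nat.gcd_dvd_right u v)
    have hc0 : c ≠ 0 := by rintro rfl; exact hu (zero_dvd_iff.mp hcu)
    have huc : u / c ≠ 0 := (Nat.div_ne_zero_iff_of_dvd hcu).mpr ⟨hu, hc0⟩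
    have hvc : v / c ≠ 0 := (Nat.div_ne_zero_iff_of_dvd hcv).mpr ⟨hv, hc0⟩
    rw [card_pairs_gcd_eq hu hv hcu hcv, ← card_divisors_mul_eq_card_coprime_pairs huc hvc]

/-- The Hecke relation with the natural-number cast to a commutative semiring (the form used in
sums with real weights). [cite: KowalskiMichelVanderKam2000, (10) p. 7 (derivation: divisor-function case, cast form)] -/
theorem cast_card_divisors_mul_card_divisors {R : Type*} [CommSemiring R] {u v : ℕ}
    (hu : u ≠ 0) (hv : v ≠ 0) :
    ((u.divisors.card : R) * (v.divisors.card : R)) =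
      ∑ c ∈ (Nat.gcd u v).divisors, ((((u / c) * (v / c)).divisors.card : ℕ) : R) := by
  rw [← Nat.cast_mul, card_divisors_mul_card_divisors_eq_sum hu hv, Nat.cast_sum]

end Literature.NumberTheory.Multiplicative
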